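import Summits.ResolutionOfSingularities.ResolutionOfSingularities.Theorems.SubmaximalShadowAlgebra
import HarnessLib

/-!
# Submaximal shadow cut — CHARTS (lens-4 g46, node «SubmaximalCut», slice S3)

The one-blow-up step for LAW E (`noTower_submaximalSurfaceHugging`, slice S4):

* §1 TRANSPORT of the level shadow `𝔍 = levelShadow (u) I ℓ` along an ABSTRACT blow-up step `σ : R → S` with
  exceptional parameter `g` (a nonzerodivisor), `σ(u_t) = g·u'_t`, `σ(𝔍) ⊆ (g)` and `I' = (σ(I)S : g^(ℓ+1))`:
  DOWN — `𝔍 ⊆ σ⁻¹(g·𝔔)` gives `I' ⊆ 𝔔·(u')^ℓ` (so `I' ⊆ (u')^ℓ`, and the non-degeneracy bound); UP — `𝔍 ⊆ σ⁻¹(g·𝔍')`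
  (every member of the shadow acquires exactly one exceptional factor).
* §2 CHART TRANSPORT `chart_transport`: at a point `x'` of the blow-up of a REGULAR point lying on the strict transform of
  a regular germ `K = (z ∘ ι)`, the Rees chart (`IsBlowup.exists_reesChart_stalk`, `isRsopPart_chartFamily_reesChart`)
  produces the data of §1: `g = σ(z_j)` with `j` not a `K`-index, `σ(z_t) = g·e_t`, `(e ∘ ι, g)` part of a regular
  system of parameters, `(e ∘ ι) = ` the strict-transform stalk of `K`, the controlled transform as `(σ(D) : g^n)`.

Sorry-free over landed modules. [cite: Hironaka1964, Ch. III §3 Lemma 6 p. 238; Matsumura1987, Thm. 14.2, §16;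
StacksProject, Tag 0BIQ]
-/

set_option linter.dupNamespace false

open CategoryTheory CategoryTheory.Limits AlgebraicGeometry TopologicalSpace IsLocalRing
open MvPolynomial Literature.AlgebraicGeometry.Resolution Scheme.IdealSheafData
open Summit.ResolutionOfSingularities.ResolutionOfSingularities.Theorems

universe u

namespace Summit.ResolutionOfSingularities.ResolutionOfSingularities.Theorems.HugValuationCut

/-! ## §1 Transport of the shadow along an abstract blow-up step -/

section Transport

variable {R S : Type u} [CommRing R] [CommRing S] (σ : R →+* S) {c : ℕ} (u : Fin c → R) (u' : Fin c → S)
  (g : S) (hg : g ∈ nonZeroDivisors S) (huu' : ∀ t, σ (u t) = g * u' t) (I : Ideal R) (I' : Ideal S) (ℓ : ℕ)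
  (hI : I ≤ Ideal.span (Set.range u) ^ ℓ) (hI' : ∀ y, y ∈ I' ↔ g ^ (ℓ + 1) * y ∈ I.map σ)

include huu' in
/-- a monomial of degree `ℓ` in `σ(u) = g·u'` is `g^ℓ` times the monomial in `u'`. [folklore] -/
theorem eval_monomial_transport {d : Fin c →₀ ℕ} (hd : d.degree = ℓ) (a : R) :
    σ (eval u (monomial d a)) = σ a * (g ^ ℓ * eval u' (monomial d 1)) := by
  simp only [eval_monomial, map_mul, one_mul]
  congr 1
  rw [map_finsuppProd]
  simp only [map_pow, huu', mul_pow]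
  rw [Finsupp.prod_mul]
  congr 1
  rw [Finsupp.prod, Finset.prod_pow_eq_pow_sum, ← Finsupp.degree_apply, hd]

include hg huu' hI hI' in
/-- **TRANSPORT DOWN**: if the shadow lies in `σ⁻¹(g·𝔔)` for an ideal `𝔔 ⊇ 𝔭'` of `S`, then `I' ⊆ 𝔔·𝔭'^ℓ` (every
member of `I` is a degree-`ℓ` form in `u` with coefficients in the shadow; applying `σ` produces `g^(ℓ+1)` times a
degree-`ℓ` form in `u'` with coefficients in `𝔔`). [cite: Matsumura1987, §16 Thm. 16.2] -/
theorem transform_le_mul_pow_of_levelShadow_le (hu : IsQuasiRegular u) {𝔔 : Ideal S}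
    (h : levelShadow (Ideal.span (Set.range u)) I ℓ ≤ (Ideal.span {g} * 𝔔).comap σ) :
    I' ≤ 𝔔 * Ideal.span (Set.range u') ^ ℓ := by
  -- `σ(I) S ⊆ g^(ℓ+1) · 𝔔 · 𝔭'^ℓ`
  have hmap : I.map σ ≤ Ideal.span {g ^ (ℓ + 1)} * (𝔔 * (Ideal.span (Set.range u')) ^ ℓ) := by
    rw [Ideal.map_le_iff_le_comap]
    intro f hf
    obtain ⟨F, hF, hFf⟩ := exists_isHomogeneous_of_mem_span_pow u ℓ (hI hf)
    have hcoeff := coeff_mem_levelShadow hu hI hF (hFf ▸ hf)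
    rw [Ideal.mem_comap, ← hFf, F.as_sum, map_sum, map_sum]
    refine Ideal.sum_mem _ fun d hd => ?_
    have hdeg : d.degree = ℓ := by
      rw [Finsupp.degree_eq_weight_one]; exact hF (mem_support_iff.mp hd)
    obtain ⟨q, hq, hgq⟩ := Ideal.mem_span_singleton_mul.mp (Ideal.mem_comap.mp (h (hcoeff d)))
    rw [eval_monomial_transport σ u u' g huu' ℓ hdeg, ← hgq, mul_assoc, ← mul_assoc q, mul_comm q, mul_assoc,
      ← mul_assoc g, ← pow_succ']
    refine Ideal.mul_mem_mul (Ideal.mem_span_singleton_self _) (Ideal.mul_mem_mul hq ?_)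
    exact eval_mem_span_pow u' (isHomogeneous_monomial _ hdeg)
  intro y hy
  obtain ⟨w, hw, hgw⟩ := Ideal.mem_span_singleton_mul.mp (hmap ((hI' y).mp hy))
  have hyw : y = w := (mul_cancel_left_mem_nonZeroDivisors (pow_mem hg (ℓ + 1))).mp hgw.symm
  rw [hyw]; exact hw

include hg huu' hI hI' in
/-- **the transform lies in `𝔭'^ℓ`** (transport down with `𝔔 = ⊤`: the shadow maps into `(g)`). [folklore] -/
theorem transform_le_pow (hu : IsQuasiRegular u)
    (h : levelShadow (Ideal.span (Set.range u)) I ℓ ≤ (Ideal.span {g}).comap σ) :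
    I' ≤ Ideal.span (Set.range u') ^ ℓ := by
  have h' : (levelShadow (Ideal.span (Set.range u)) I ℓ) ≤ (Ideal.span {g} * ⊤).comap σ := by rwa [Ideal.mul_top]
  simpa only [Ideal.top_mul] using transform_le_mul_pow_of_levelShadow_le σ u u' g hg huu' I I' ℓ hI hI' hu h'

include hg huu' hI hI' in
/-- **TRANSPORT UP**: every member `x` of the shadow acquires exactly one exceptional factor, `σ(x) ∈ g·𝔍'` — provided
`u'` is quasi-regular too and the shadow maps into `(g)` (the coefficients `a` of a representation of `f ∈ I` map to
`g·a'`, and `a'` are the coefficients of a representation of `σ(f)/g^(ℓ+1) ∈ I'`). [cite: Matsumura1987, §16 Thm. 16.2] -/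
theorem levelShadow_le_comap_mul (hu : IsQuasiRegular u) (hu' : IsQuasiRegular u')
    (h : levelShadow (Ideal.span (Set.range u)) I ℓ ≤ (Ideal.span {g}).comap σ) :
    levelShadow (Ideal.span (Set.range u)) I ℓ ≤
      (Ideal.span {g} * levelShadow (Ideal.span (Set.range u')) I' ℓ).comap σ := by
  classical
  have hI'p : I' ≤ (Ideal.span (Set.range u')) ^ ℓ := transform_le_pow σ u u' g hg huu' I I' ℓ hI hI' hu h
  refine levelShadow_le ?_ ?_
  · -- `(Ideal.span (Set.range u)) ⊆ σ⁻¹(g·(levelShadow (Ideal.span (Set.range u')) I' ℓ))`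
    rw [Ideal.span_le]
    rintro _ ⟨t, rfl⟩
    rw [SetLike.mem_coe, Ideal.mem_comap, huu']
    exact Ideal.mul_mem_mul (Ideal.mem_span_singleton_self g)
      (le_levelShadow _ _ _ (Ideal.subset_span (Set.mem_range_self t)))
  · -- `I ⊆ σ⁻¹(g·(levelShadow (Ideal.span (Set.range u')) I' ℓ)) · (Ideal.span (Set.range u))^ℓ`
    intro f hf
    obtain ⟨F, hF, hFf⟩ := exists_isHomogeneous_of_mem_span_pow u ℓ (hI hf)
    have hcoeff := coeff_mem_levelShadow hu hI hF (hFf ▸ hf)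
    -- divide the coefficients by `g`
    have hdiv : ∀ d, ∃ a' : S, g * a' = σ (F.coeff d) := fun d =>
      Ideal.mem_span_singleton'.mp (Ideal.mem_comap.mp (h (hcoeff d))) |>.imp fun a' ha' => by
        rw [mul_comm]; exact ha'
    choose a' ha' using hdiv
    -- the transported form
    set G : MvPolynomial (Fin c) S := ∑ d ∈ F.support, monomial d (a' d) with hGdef
    have hdeg : ∀ d ∈ F.support, d.degree = ℓ := fun d hd => by
      rw [Finsupp.degree_eq_weight_one]; exact hF (mem_support_iff.mp hd)
    have hG : G.IsHomogeneous ℓ :=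
      IsHomogeneous.sum F.support (fun d => monomial d (a' d)) ℓ fun d hd => isHomogeneous_monomial _ (hdeg d hd)
    -- `σ(f) = g^(ℓ+1) · G(u')`
    have hσf : σ f = g ^ (ℓ + 1) * eval u' G := by
      rw [← hFf, F.as_sum, map_sum, map_sum, hGdef, map_sum, Finset.mul_sum]
      refine Finset.sum_congr rfl fun d hd => ?_
      rw [eval_monomial_transport σ u u' g huu' ℓ (hdeg d hd), ← ha' d, pow_succ', eval_monomial,
        eval_monomial, one_mul]
      ring
    have hGI' : eval u' G ∈ I' := (hI' _).mpr (hσf ▸ Ideal.mem_map_of_mem σ hf)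
    have hGcoeff := coeff_mem_levelShadow hu' hI'p hG hGI'
    -- coefficients of `G`
    have hcoeffG : ∀ d ∈ F.support, G.coeff d = a' d := by
      intro d hd
      rw [hGdef, coeff_sum, Finset.sum_eq_single d]
      · rw [coeff_monomial, if_pos rfl]
      · intro b _ hb; rw [coeff_monomial, if_neg hb]
      · intro hd'; exact absurd hd hd'
    -- conclude: the coefficients of `F` lie in `σ⁻¹(g·𝔍')`
    have hFc : ∀ d, F.coeff d ∈ (Ideal.span {g} * (levelShadow (Ideal.span (Set.range u')) I' ℓ)).comap σ := by
      intro d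
      by_cases hd : d ∈ F.support
      · rw [Ideal.mem_comap, ← ha' d, ← hcoeffG d hd]
        exact Ideal.mul_mem_mul (Ideal.mem_span_singleton_self g) (hGcoeff d)
      · rw [notMem_support_iff.mp hd]; exact zero_mem _
    rw [← hFf]
    exact eval_mem_mul_span_pow u hF (mem_map_C_iff.mpr hFc)

include hg in
/-- cancellation of the exceptional factor: `g·y ∈ g·𝔎` gives `y ∈ 𝔎`. [folklore] -/
theorem mem_of_mul_mem_span_singleton_mul {𝔎 : Ideal S} {y : S} (h : g * y ∈ Ideal.span {g} * 𝔎) : y ∈ 𝔎 := by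
  obtain ⟨w, hw, hgw⟩ := Ideal.mem_span_singleton_mul.mp h
  rwa [(mul_cancel_left_mem_nonZeroDivisors hg).mp hgw.symm]

end Transport


/-! ## §2 Chart transport at a point of the blow-up of a regular point -/

section PointStep

variable {X X' : Scheme.{0}} [IsLocallyNoetherian X'] (π : X' ⟶ X) (Z K D : X.IdealSheafData)

set_option maxHeartbeats 400000 in
/-- **CHART TRANSPORT.**  `π` the blow-up of `Z` with `Z_{π x'} = 𝔪` (a regular point), `z` a regular system of
parameters at `π x'` of which the sub-family `z ∘ ι` generates the stalk `K_{π x'}`, and `x'` a point of the strict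
transform of `K`.  Then, in the Rees chart `𝒪_{x'} = 𝒪[𝔪/z_j]_𝔴` through which `σ = π^#_{x'}` factors: the
exceptional index `j` is NOT a `K`-index; `g = σ(z_j)` is a nonzerodivisor generating the exceptional stalk;
`σ(z_t) = g·e_t`; `(u', g)`, `u' = e ∘ ι`, is part of a regular system of parameters; `(u')` IS the strict-transform
stalk of `K`; the controlled transform of `D` (control `n`) is `(σ(D)𝒪 : g^n)`; and every further chart generator
`e_{t₀} ∈ 𝔪_{x'}` enlarges `(u', g)` to a longer regular-parameter family.
[cite: Hironaka1964, Ch. III §3 Lemma 6 p. 238; StacksProject, Tag 0BIQ; Matsumura1987, Thm. 14.2] -/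
theorem chart_transport (hπ : IsBlowup π Z) (x' : X') [IsRegularLocalRing (X.presheaf.stalk (π.base x'))]
    (hZ : stalkIdeal Z (π.base x') = maximalIdeal _) {c d : ℕ} (z : Fin d → X.presheaf.stalk (π.base x'))
    (hz : Ideal.span (Set.range z) = maximalIdeal _)
    (hrank : (maximalIdeal (X.presheaf.stalk (π.base x'))).spanFinrank = d)
    (ι : Fin c → Fin d) (hι : Function.Injective ι)
    (hK : Ideal.span (Set.range (z ∘ ι)) = stalkIdeal K (π.base x'))
    (hx' : x' ∈ ((strictTransformIdeal π Z K).support : Set X')) (n : ℕ) :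
    ∃ (j : Fin d) (e : Fin d → X'.presheaf.stalk x'),
      j ∉ Set.range ι ∧ (π.stalkMap x').hom (z j) ∈ nonZeroDivisors _ ∧
      (∀ t, (π.stalkMap x').hom (z t) = (π.stalkMap x').hom (z j) * e t) ∧
      IsRsopPart (Fin.snoc (e ∘ ι) ((π.stalkMap x').hom (z j)) : Fin (c + 1) → _) ∧
      Ideal.span (Set.range (e ∘ ι)) = stalkIdeal (strictTransformIdeal π Z K) x' ∧
      (∀ y, y ∈ stalkIdeal (controlledTransform π Z D n) x' ↔
        (π.stalkMap x').hom (z j) ^ n * y ∈ (stalkIdeal D (π.base x')).map (π.stalkMap x').hom) ∧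
      (∀ t₀, t₀ ∉ Set.range ι → t₀ ≠ j → e t₀ ∈ maximalIdeal _ →
        IsRsopPart (Fin.snoc (Fin.cons (e t₀) (e ∘ ι) : Fin (c + 1) → _) ((π.stalkMap x').hom (z j)) :
          Fin (c + 1 + 1) → _)) := by
  have h𝔭'le : stalkIdeal (strictTransformIdeal π Z K) x' ≤ maximalIdeal _ :=
    (mem_support_iff_stalkIdeal_le _ _).mp hx'
  have hc' : Ideal.span (Set.range z) = stalkIdeal Z (π.base x') := by rw [hZ]; exact hz
  obtain ⟨j, 𝔴, χ, hχ, hloc, h𝔴⟩ := hπ.exists_reesChart_stalk x' z hc'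
  letI := χ.toAlgebra
  haveI : IsLocalization.AtPrime (X'.presheaf.stalk x') 𝔴.asIdeal := hloc
  have hχa : (algebraMap (chartRing z j) (X'.presheaf.stalk x') : _ →+* _) = χ := RingHom.algebraMap_toAlgebra χ
  -- the chart generators `e_t` and the exceptional parameter `g = σ(z_j)`
  let e : Fin d → X'.presheaf.stalk x' := fun t => χ (chartGen z j t)
  have hzt : ∀ t, (π.stalkMap x').hom (z t) = (π.stalkMap x').hom (z j) * e t := fun t => by
    rw [← hχ, ← hχ, reesChartBase_apply_eq_mul_chartGen z j t, map_mul]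
  have hgnzd : (π.stalkMap x').hom (z j) ∈ nonZeroDivisors _ := by
    have h1 : (π.stalkMap x').hom (z j) =
        (algebraMap (chartRing z j) (X'.presheaf.stalk x') : chartRing z j →+* _) (chartBase z j (z j)) := by
      rw [hχa, hχ]
    rw [h1]
    exact IsLocalization.nonZeroDivisors_le_comap 𝔴.asIdeal.primeCompl (X'.presheaf.stalk x')
      (reesChartBase_mem_nonZeroDivisors _ _)
  have hE : stalkIdeal (Z.comap π) x' = Ideal.span {(π.stalkMap x').hom (z j)} := by
    rw [stalkIdeal_comap_eq_map_stalkMap, ← hc', Ideal.map_span]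
    apply le_antisymm
    · rw [Ideal.span_le]
      rintro _ ⟨_, ⟨l, rfl⟩, rfl⟩
      rw [SetLike.mem_coe, Ideal.mem_span_singleton']
      exact ⟨e l, by rw [mul_comm]; exact (hzt l).symm⟩
    · exact (Ideal.span_singleton_le_iff_mem _).mpr (Ideal.subset_span ⟨z j, ⟨j, rfl⟩, rfl⟩)
  have hst : stalkIdeal (strictTransformIdeal π Z K) x' =
      stOp (π.stalkMap x').hom (Ideal.span {(π.stalkMap x').hom (z j)}) (stalkIdeal K (π.base x')) := by
    rw [stalkIdeal_strictTransformIdeal_eq_stOp, hE]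
  have hzK : ∀ t, z (ι t) ∈ stalkIdeal K (π.base x') := fun t => by
    rw [← hK]; exact Ideal.subset_span ⟨t, rfl⟩
  -- (i) `e_{ι t}` lies on the strict transform
  have he𝔭' : ∀ t, e (ι t) ∈ stalkIdeal (strictTransformIdeal π Z K) x' := fun t => by
    rw [hst, mem_stOp_iff]
    refine ⟨1, ?_⟩
    rw [pow_one, Ideal.span_singleton_mul_span_singleton, Ideal.span_singleton_le_iff_mem, mul_comm, ← hzt]
    exact Ideal.mem_map_of_mem _ (hzK t)
  -- (ii) hence the chart generator `chartGen (ι t)` lies in `𝔴`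
  have h𝔴t : ∀ t, chartGen z j (ι t) ∈ 𝔴.asIdeal := fun t => by
    have h1 : (algebraMap (chartRing z j) (X'.presheaf.stalk x') : chartRing z j →+* _) (chartGen z j (ι t)) ∈
        maximalIdeal _ := by
      rw [hχa]; exact h𝔭'le (he𝔭' t)
    exact (IsLocalization.AtPrime.to_map_mem_maximal_iff (X'.presheaf.stalk x') 𝔴.asIdeal _).mp h1
  -- (iii) the exceptional index is not a `K`-index
  have hj : j ∉ Set.range ι := by
    rintro ⟨t, ht⟩
    have hjj : chartGen z j j = 1 := chartGen_self z j
    have h1 : e (ι t) = 1 := by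
      show χ (chartGen z j (ι t)) = 1
      rw [ht, hjj, map_one]
    have h2 := he𝔭' t
    rw [h1] at h2
    exact (maximalIdeal.isMaximal _).ne_top (Ideal.eq_top_of_isUnit_mem _ (h𝔭'le h2) isUnit_one)
  -- (iv) regular-parameter families read off the chart
  have hzw : Ideal.span (Set.range (Fin.append z (fun i : Fin 0 => i.elim0))) =
      maximalIdeal (X.presheaf.stalk (π.base x')) := by
    rw [range_fin_append, Set.range_eq_empty (fun i : Fin 0 => _), Set.union_empty, hz]
  have hd0 : (maximalIdeal (X.presheaf.stalk (π.base x'))).spanFinrank = d + 0 := hrank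
  have family : ∀ {a : ℕ} (jJ : Fin a → Fin d), Function.Injective jJ → (∀ k, jJ k ≠ j) →
      (∀ k, chartGen z j (jJ k) ∈ 𝔴.asIdeal) →
      IsRsopPart (Fin.snoc (e ∘ jJ) ((π.stalkMap x').hom (z j)) : Fin (a + 1) → _) := by
    intro a jJ hjJ hjne hJ
    have hfam := isRsopPart_chartFamily_reesChart z j (fun i : Fin 0 => i.elim0) hzw hd0 𝔴.asIdeal h𝔴
      (X'.presheaf.stalk x') (fun k => (⟨jJ k, hjne k⟩ : {t // t ≠ j}))
      (fun a b h => hjJ (congrArg Subtype.val h)) hJ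
    have heq : chartFamily z j (fun i : Fin 0 => i.elim0) (X'.presheaf.stalk x') (chartBase z j) (chartGen z j)
        (fun k => (⟨jJ k, hjne k⟩ : {t // t ≠ j})) =
        (Fin.cons ((π.stalkMap x').hom (z j)) (e ∘ jJ) : Fin (a + 0 + 1) → _) := by
      funext i
      refine Fin.cases ?_ (fun k => ?_) i
      · simp only [chartFamily, Fin.cons_zero, hχa, hχ]
      · simp only [chartFamily, Fin.cons_succ]
        show _ = χ (chartGen z j (jJ k))
        rw [← hχa]
        exact Fin.append_left
          (fun k => (algebraMap (chartRing z j) (X'.presheaf.stalk x') : chartRing z j →+* _) (chartGen z j (jJ k)))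
          _ k
    rw [heq] at hfam
    have h2 := hfam.comp (finRotate (a + 1)) (finRotate _).injective
    rw [Function.comp_def, ← Fin.snoc_eq_cons_rotate] at h2
    exact h2
  have hsnoc : IsRsopPart (Fin.snoc (e ∘ ι) ((π.stalkMap x').hom (z j)) : Fin (c + 1) → _) :=
    family ι hι (fun t h => hj ⟨t, h⟩) h𝔴t
  -- (v) `𝔭' = (u')`
  have h𝔭' : Ideal.span (Set.range (e ∘ ι)) = stalkIdeal (strictTransformIdeal π Z K) x' := by
    apply le_antisymm
    · rw [Ideal.span_le]
      rintro _ ⟨t, rfl⟩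
      exact he𝔭' t
    · intro y hy
      rw [hst, mem_stOp_iff] at hy
      obtain ⟨N, hN⟩ := hy
      have hKmap : (stalkIdeal K (π.base x')).map (π.stalkMap x').hom ≤
          Ideal.span {(π.stalkMap x').hom (z j)} * Ideal.span (Set.range (e ∘ ι)) := by
        rw [← hK, Ideal.map_span, Ideal.span_le]
        rintro _ ⟨_, ⟨t, rfl⟩, rfl⟩
        rw [SetLike.mem_coe, Function.comp_apply, hzt (ι t)]
        exact Ideal.mul_mem_mul (Ideal.mem_span_singleton_self _)
          (Ideal.subset_span (s := Set.range (e ∘ ι)) (Set.mem_range_self t))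
      have h1 : y * (π.stalkMap x').hom (z j) ^ N ∈
          Ideal.span {(π.stalkMap x').hom (z j)} * Ideal.span (Set.range (e ∘ ι)) := by
        refine hKmap (hN ?_)
        rw [Ideal.span_singleton_pow, Ideal.span_singleton_mul_span_singleton]
        exact Ideal.mem_span_singleton_self _
      rcases N with _ | N
      · rw [pow_zero, mul_one] at h1
        exact Ideal.mul_le_left h1
      · rw [pow_succ, ← mul_assoc, mul_comm (y * _)] at h1
        have h2 := mem_of_mul_mem_span_singleton_mul _ hgnzd h1
        rw [mul_comm] at h2
        exact mem_span_of_pow_mul_mem hsnoc h2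
  -- (vi) the controlled transform of `D`
  have hI' : ∀ y, y ∈ stalkIdeal (controlledTransform π Z D n) x' ↔
      (π.stalkMap x').hom (z j) ^ n * y ∈ (stalkIdeal D (π.base x')).map (π.stalkMap x').hom := by
    intro y
    rw [hπ.stalkIdeal_controlledTransform D n x', hE, stalkIdeal_comap_eq_map_stalkMap,
      ← span_singleton_mul_le_iff_mem_colon, Ideal.span_singleton_pow, Ideal.span_singleton_mul_span_singleton,
      Ideal.span_singleton_le_iff_mem, mul_comm]
  -- (vii) enlarged families
  have hbig : ∀ t₀, t₀ ∉ Set.range ι → t₀ ≠ j → e t₀ ∈ maximalIdeal _ →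
      IsRsopPart (Fin.snoc (Fin.cons (e t₀) (e ∘ ι) : Fin (c + 1) → _) ((π.stalkMap x').hom (z j)) :
        Fin (c + 1 + 1) → _) := by
    intro t₀ ht₀ ht₀j hm
    have h𝔴₀ : chartGen z j t₀ ∈ 𝔴.asIdeal := by
      have h1 : (algebraMap (chartRing z j) (X'.presheaf.stalk x') : chartRing z j →+* _) (chartGen z j t₀) ∈
          maximalIdeal _ := by
        rw [hχa]; exact hm
      exact (IsLocalization.AtPrime.to_map_mem_maximal_iff (X'.presheaf.stalk x') 𝔴.asIdeal _).mp h1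
    -- pointwise facts along `Fin.cons t₀ ι`, proved for a generic predicate (keeps the chart ring out of `rw`)
    have hP : ∀ P : Fin d → Prop, P t₀ → (∀ t, P (ι t)) → ∀ k, P ((Fin.cons t₀ ι : Fin (c + 1) → Fin d) k) := by
      intro P h0 hs k
      refine Fin.cases ?_ (fun t => ?_) k
      · rw [Fin.cons_zero]; exact h0
      · rw [Fin.cons_succ]; exact hs t
    have h := family (Fin.cons t₀ ι : Fin (c + 1) → Fin d) (Fin.cons_injective_iff.mpr ⟨ht₀, hι⟩)
      (hP (fun t => t ≠ j) ht₀j fun t h => hj ⟨t, h⟩) (hP (fun t => chartGen z j t ∈ 𝔴.asIdeal) h𝔴₀ h𝔴t)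
    rw [Fin.comp_cons] at h
    exact h
  exact ⟨j, e, hj, hgnzd, hzt, hsnoc, h𝔭', hI', hbig⟩

end PointStep

end Summit.ResolutionOfSingularities.ResolutionOfSingularities.Theorems.HugValuationCut
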